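import Summits.MatrixMultiplication.MatrixMultiplication.Theorems.SaturationLadderBandClauses
import Summits.MatrixMultiplication.MatrixMultiplication.Theorems.SaturationLadderCornerFamily
import HarnessLib

/-!
# SaturationLadder — Kernel XXIX: the eventual clause above the class ceiling with a FORMULA onset

Support for the deciding crux `SubexpSaturation` (h₁, item 25909) of `Theses/SaturationLadder.lean`
(cell `decomp-mm`, lens «grading / quantitative ladder», gen 57).  No definitions, no named facts,
no `sorry`.  Successor of `…BandClauses` (Kernel XXVIII (iv)): the table of flat-rate tail clauses
`clause_p_q` becomes ONE theorem with the onset as a closed formula of the rate.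

Write `c₂ = (5 log(5/4) + 3 log 2)/3 = 1.0650531…` (the class ceiling, `…CornerFamily.classCeiling_bounds`),
`Δ = C − c₂`.  MAIN THEOREM (`clause_delta`, `clause_explicit`): for every rate `C > c₂`

  `∀ t ∈ [t₀(C), 1)  ∃ r ∈ [1, e^{C/(1−t)}],  ω(1,t,r) = 1 + r (≤)`,
  `t₀(C) = max(11/12, 1 − 81Δ/(80 + 162Δ)) = 1 − (81/80)Δ + O(Δ²)`.

This replaces the non-explicit `∃ t₀` of `…GaugeConeClasses.clause_above_classCeiling` (pencil regime
`j ≥ 1000 ∧ jδ ≥ 30`) by a formula, and it dominates the XXVIII table away from the table constants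
(e.g. `C = 1.07`: `t₀ = 0.99505` here vs `0.99546` from `clause_13_16`).  The band method cannot do much
better: its optimal onset (real `κ ↑ κ_C`, least band index) is `1 − t₀ ≈ (3/2)(1+2κ₀/3)/c₁(κ₀) · Δ
≈ 1.29Δ` asymptotically (`1.25Δ` at `C = 1.08`; instrument `gen57/num/explicit_onset_check.py`),
against `(81/80)Δ = 1.0125Δ` certified here — the loss is the rational rounding `δ ≥ (27/20)Δ` and
the crude band bound `2 ≤ jδ`.

MECHANISM (the adaptive member).  `log θ(κ) − c₂ = (2/3) δ(κ)` (`logTheta_sub_classCeiling`;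
`log θ(κ) = (1+2κ/3) log 2`, `δ(κ) = κ log 2 − (5/2) log(5/4) = (κ − κ₀) log 2`), so the rate condition
`log θ(p/q) ≤ C` reads `δ(p/q) ≤ (3/2)Δ` while the band onset wants `δ` LARGE.  `exists_member` picks
`q = ⌈20 log 2/(3Δ)⌉`, `p = ⌈q((5/2) log(5/4) + (27/20)Δ)/log 2⌉`, giving `δ(p/q) ∈ [(27/20)Δ, (3/2)Δ]`,
`p ≤ q`, `4q ≤ 5p` (`eight_log_two_lt`: `κ₀ > 4/5`); the band holds from `j₀ = max(16, ⌈2/δ⌉)`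
(`band_of_two_le`: `c₁ ≤ 15/8` and `j ≥ 16` give `c₁ j + 2 ≤ 2j ≤ j²δ`); the onset abscissa satisfies
`1 − t_{j₀} ≥ 3/(2(j₀+2))` (`one_sub_t_ge`, needs `3q ≤ 4p`); then `…BandClauses.memberClause`.
For `C ≥ (5/3) log 2` the member `κ = 1`, `j₀ = 16` serves (`t₀ ≥ 11/12 > 200/221`).

CONTINUUM FORM (`ceiling_continuum`, `ceiling_continuum_defect`): inverting the formula,

  `∀ t ∈ [11/12, 1)  ∃ r ∈ [1, e^{c₂/(1−t) + 6/5}]  exact`,   i.e. `(1−t) log r ≤ c₂ + (6/5)(1−t)`: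

the class ceiling is attained along the WHOLE continuum `t ↑ 1` (the corner family of XXVIII (iii) gave
`D_j ≤ c₂ + 2 log 2/j ≈ c₂ + 0.9(1−t_j)` only at its own abscissae `t_j`).  Instances (`clause_107`,
`clause_1066`, `clause_10655`, `clause_10651`): rates `1.07 / 1.066 / 1.0655 / 1.0651` from
`t = 0.99505 / 0.99906 / 0.99956 / 0.99996`.

Currency (honest label): every statement here is WEAKER than h₁ (necessary direction only: h₁ asks the
clause for all `c > 0`; by `…GaugeConeClasses.subexpSaturation_iff_clause_le_classCeiling` the open
content is exactly `c ∈ (0, c₂]`, untouched here).  After this file the route's eventual-explicit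
currency is the formula `t₀(C)` on the whole half-line `C > c₂`; the uniform currency `U(1.09)` is unchanged.

References: D. Coppersmith, S. Winograd, J. Symbolic Comput. 9 (1990) §8 (key
`CoppersmithWinograd1990`); J. Alman, R. Duan, V. Vassilevska Williams, Y. Xu, Z. Xu, R. Zhou, SODA
2025, Thm. 3.2 and §3.4 (key `AlmanDuanVassilevskaWilliamsXuXuZhou2025`).
-/

set_option linter.dupNamespace false
-- (single-conjunct summit: the namespace repeats `MatrixMultiplication`)

noncomputable section

namespace Summit.MatrixMultiplication.MatrixMultiplication.Theorems.SaturationLadderExplicitCeilingClause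

open Literature.Computability.AlgebraicComplexity
open Summit.MatrixMultiplication.MatrixMultiplication.Theorems.SaturationLadderBandClauses
  (memberClause)
open Summit.MatrixMultiplication.MatrixMultiplication.Theorems.SaturationLadderTwinCeilingPencil
  (one_sub_t)
open Summit.MatrixMultiplication.MatrixMultiplication.Theorems.SaturationLadderTwinFamilyY64
  (log_five_halves_le_d7)
open Summit.MatrixMultiplication.MatrixMultiplication.Theorems.SaturationLadderCornerFamily
  (log_five_fourths_eq le_log_five_fourths log_five_fourths_le classCeiling_bounds
    le_log_five_halves_d7)

/-! ## Constants and the two identities -/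

/-- `8 log 2 < 25 log(5/4)`, i.e. `4/5 < κ₀ = (5/2) log₂(5/4) = 0.80482…`. [folklore] -/
theorem eight_log_two_lt : 8 * Real.log 2 < 25 * Real.log (5 / 4) := by
  linarith [le_log_five_fourths, Real.log_two_lt_d9]

/-- `δ(κ) = (5/2 + κ) log 2 − (5/2) log(5/2) = κ log 2 − (5/2) log(5/4)`. [folklore] -/
theorem delta_eq (κ : ℝ) :
    (5 / 2 + κ) * Real.log 2 - 5 / 2 * Real.log (5 / 2) = κ * Real.log 2 - 5 / 2 * Real.log (5 / 4) := by
  rw [log_five_fourths_eq]; ring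

/-- **`log θ(κ) − c₂ = (2/3) δ(κ)`**: the rate of the member `κ` exceeds the class ceiling by two thirds
of its band parameter (`log θ(κ) = (1 + 2κ/3) log 2`). [folklore] -/
theorem logTheta_sub_classCeiling (κ : ℝ) :
    (1 + 2 * κ / 3) * Real.log 2 - (5 * Real.log (5 / 4) + 3 * Real.log 2) / 3 =
      2 / 3 * (κ * Real.log 2 - 5 / 2 * Real.log (5 / 4)) := by
  ring

/-! ## Three lemmas on the pencil -/

/-- **`3/(2(j+2)) ≤ 1 − t_j`** for `3q ≤ 4p` (`0 < q`), `t_j = j(3qj+2q)/((j+1)(3qj+2q+2p))`: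
`2(j+2)((3q+2p)j + 2q+2p) − 3(j+1)(3qj+2q+2p) = (4p−3q)j² + (q+6p)j + 2q+2p ≥ 0`. [folklore] -/
theorem one_sub_t_ge (p q j : ℕ) (hq : 0 < q) (h34 : 3 * q ≤ 4 * p) :
    3 / (2 * ((j : ℝ) + 2)) ≤
      1 - ((j : ℝ) * ((3 * q * j + 2 * q : ℕ) : ℝ)) /
        (((j : ℝ) + 1) * ((3 * q * j + 2 * q + 2 * p : ℕ) : ℝ) + ((0 : ℕ) : ℝ)) := by
  rw [one_sub_t p q j _ _ rfl rfl hq]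
  have hq' : (0 : ℝ) < q := by exact_mod_cast hq
  have h34' : 3 * (q : ℝ) ≤ 4 * p := by exact_mod_cast h34
  have hj0 : (0 : ℝ) ≤ j := Nat.cast_nonneg _
  have hp0 : (0 : ℝ) ≤ p := Nat.cast_nonneg _
  rw [div_le_div_iff₀ (by positivity) (by positivity)]
  have h1 : 0 ≤ (4 * (p : ℝ) - 3 * q) * ((j : ℝ) * j) := mul_nonneg (by linarith) (by positivity)
  nlinarith [h1, hj0, hp0, hq'.le, mul_nonneg hp0 hj0, mul_nonneg hq'.le hj0]

/-- **The band from `j ≥ 16` and `j·δ ≥ 2`.**  `c₁(κ) = (1+κ) log(5/2) + (1−κ) log 2 ≤ 2 log(5/2) < 15/8`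
for `0 ≤ κ ≤ 1`, so `c₁ j + 2 ≤ (15/8) j + j/8 = 2j ≤ j·(jδ)`. [folklore] -/
theorem band_of_two_le {κ δ : ℝ} {j : ℕ} (hκ0 : 0 ≤ κ) (hκ1 : κ ≤ 1) (hj : 16 ≤ j)
    (hjδ : 2 ≤ (j : ℝ) * δ) :
    ((1 + κ) * Real.log (5 / 2) + (1 - κ) * Real.log 2) * (j : ℝ) + 2 ≤ (j : ℝ) ^ 2 * δ := by
  have hJ : (16 : ℝ) ≤ j := by exact_mod_cast hj
  have hP := log_five_halves_le_d7
  have hl2' := Real.log_two_lt_d9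
  have h1 : (1 + κ) * Real.log (5 / 2) ≤ (1 + κ) * 0.9162908 :=
    mul_le_mul_of_nonneg_left hP (by linarith)
  have h2 : (1 - κ) * Real.log 2 ≤ (1 - κ) * 0.6931471808 :=
    mul_le_mul_of_nonneg_left hl2'.le (by linarith)
  have hc : (1 + κ) * Real.log (5 / 2) + (1 - κ) * Real.log 2 ≤ 15 / 8 := by linarith
  have e : (j : ℝ) ^ 2 * δ = (j : ℝ) * ((j : ℝ) * δ) := by ring
  rw [e]
  have h3 := mul_le_mul_of_nonneg_right hc (by linarith : (0 : ℝ) ≤ j)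
  have h4 := mul_le_mul_of_nonneg_left hjδ (by linarith : (0 : ℝ) ≤ j)
  linarith

/-- **The adaptive member.**  For `0 < Δ` with `(5/2) log(5/4) + (3/2)Δ ≤ log 2` (i.e. `c₂ + Δ ≤ (5/3) log 2`)
there are naturals `p ≤ q`, `0 < q`, `4q ≤ 5p` with `δ(p/q) = (p/q) log 2 − (5/2) log(5/4) ∈ [(27/20)Δ, (3/2)Δ]`:
`q = ⌈20 log 2/(3Δ)⌉`, `p = ⌈q x⌉`, `x = ((5/2) log(5/4) + (27/20)Δ)/log 2`. [folklore] -/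
theorem exists_member {Δ : ℝ} (hΔ : 0 < Δ)
    (hΔ1 : 5 / 2 * Real.log (5 / 4) + 3 / 2 * Δ ≤ Real.log 2) :
    ∃ p q : ℕ, 0 < q ∧ p ≤ q ∧ 4 * q ≤ 5 * p ∧
      27 / 20 * Δ ≤ (p : ℝ) / q * Real.log 2 - 5 / 2 * Real.log (5 / 4) ∧
      (p : ℝ) / q * Real.log 2 - 5 / 2 * Real.log (5 / 4) ≤ 3 / 2 * Δ := by
  have hl2 := Real.log_two_gt_d9
  have hL := le_log_five_fourths
  have h8 := eight_log_two_lt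
  have hℓ : 0 < Real.log 2 := by linarith
  -- the denominator `q`
  obtain ⟨q, hqdef⟩ : ∃ q : ℕ, q = ⌈20 * Real.log 2 / (3 * Δ)⌉₊ := ⟨_, rfl⟩
  have hq_ge : 20 * Real.log 2 / (3 * Δ) ≤ (q : ℝ) := by rw [hqdef]; exact Nat.le_ceil _
  have hq : 0 < q := by
    rw [hqdef]; exact Nat.ceil_pos.mpr (div_pos (by linarith) (by linarith))
  have hq' : (0 : ℝ) < q := by exact_mod_cast hq
  have hqΔ : 20 * Real.log 2 ≤ (q : ℝ) * (3 * Δ) := (div_le_iff₀ (by linarith)).1 hq_ge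
  -- the target ratio `x` and the numerator `p`
  obtain ⟨x, hxdef⟩ : ∃ x : ℝ, x = (5 / 2 * Real.log (5 / 4) + 27 / 20 * Δ) / Real.log 2 := ⟨_, rfl⟩
  have hx0 : 0 < x := by rw [hxdef]; exact div_pos (by linarith) hℓ
  have hxℓ : x * Real.log 2 = 5 / 2 * Real.log (5 / 4) + 27 / 20 * Δ := by
    rw [hxdef]; field_simp
  obtain ⟨p, hpdef⟩ : ∃ p : ℕ, p = ⌈(q : ℝ) * x⌉₊ := ⟨_, rfl⟩
  have hp_ge : (q : ℝ) * x ≤ p := by rw [hpdef]; exact Nat.le_ceil _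
  have hp_lt : (p : ℝ) < (q : ℝ) * x + 1 := by
    rw [hpdef]; exact Nat.ceil_lt_add_one (mul_nonneg hq'.le hx0.le)
  -- `y = (p/q) log 2 ∈ [x log 2, x log 2 + (3/20)Δ]`
  have hy_lo : x * Real.log 2 ≤ (p : ℝ) / q * Real.log 2 := by
    apply mul_le_mul_of_nonneg_right _ hℓ.le
    rw [le_div_iff₀ hq']; linarith
  have hy_hi : (p : ℝ) / q * Real.log 2 ≤ x * Real.log 2 + 3 / 20 * Δ := by
    have h1 : (p : ℝ) / q ≤ x + 1 / q := by
      rw [div_le_iff₀ hq', add_mul, one_div_mul_cancel hq'.ne']; linarith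
    have h2 : (p : ℝ) / q * Real.log 2 ≤ (x + 1 / q) * Real.log 2 :=
      mul_le_mul_of_nonneg_right h1 hℓ.le
    have h3 : 1 / (q : ℝ) * Real.log 2 ≤ 3 / 20 * Δ := by
      rw [one_div_mul_eq_div, div_le_iff₀ hq']; linarith
    linarith [h2, h3]
  refine ⟨p, q, hq, ?_, ?_, by linarith [hy_lo, hxℓ], by linarith [hy_hi, hxℓ]⟩
  · -- `p ≤ q`
    have h : (p : ℝ) / q * Real.log 2 ≤ 1 * Real.log 2 := by linarith [hy_hi, hxℓ, hΔ1]
    have h' : (p : ℝ) / q ≤ 1 := le_of_mul_le_mul_right h hℓ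
    have h'' : (p : ℝ) ≤ q := by rwa [div_le_one hq'] at h'
    exact_mod_cast h''
  · -- `4q ≤ 5p` (`κ₀ > 4/5`)
    have h : 4 / 5 * Real.log 2 < (p : ℝ) / q * Real.log 2 := by linarith [hy_lo, hxℓ, h8, hΔ]
    have h' : 4 / 5 < (p : ℝ) / q := lt_of_mul_lt_mul_right h hℓ.le
    have h'' : 4 * (q : ℝ) < 5 * p := by
      rw [lt_div_iff₀ hq'] at h'; linarith
    exact_mod_cast h''.le

/-! ## The main theorem -/

/-- **The eventual clause at rate `c₂ + Δ`, formula onset** (`0 < Δ`): for every `t` with `11/12 ≤ t`,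
`1 − 81Δ/(80 + 162Δ) ≤ t`, `t < 1` some `r ∈ [1, e^{(c₂+Δ)/(1−t)}]` has `ω(1,t,r) = 1 + r` (`≤`).
[cite: CoppersmithWinograd1990, §8] [cite: AlmanDuanVassilevskaWilliamsXuXuZhou2025, Thm. 3.2, §3.4] -/
theorem clause_delta {Δ : ℝ} (hΔ : 0 < Δ) :
    ∀ t : ℝ, 11 / 12 ≤ t → 1 - 81 * Δ / (80 + 162 * Δ) ≤ t → t < 1 →
      ∃ r : ℝ, 1 ≤ r ∧ r ≤ Real.exp (((5 * Real.log (5 / 4) + 3 * Real.log 2) / 3 + Δ) / (1 - t)) ∧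
        omegaRect ℂ 1 t r ≤ 1 + r := by
  intro t ht11 htΔ ht1
  have hl2 := Real.log_two_gt_d9
  have hl2' := Real.log_two_lt_d9
  have hP := log_five_halves_le_d7
  have hP' := le_log_five_halves_d7
  have hL := le_log_five_fourths
  have hL' := log_five_fourths_le
  have h54 := log_five_fourths_eq
  rcases le_or_gt (5 / 3 * Real.log 2) ((5 * Real.log (5 / 4) + 3 * Real.log 2) / 3 + Δ) with hbig | hsmall
  · -- the member `κ = 1` from `j₀ = 16` (`t₀ = 200/221 < 11/12`)
    refine memberClause 1 1 16 (by norm_num) (by norm_num) (by norm_num) (by norm_num)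
      (by push_cast; nlinarith) (by push_cast; linarith) t ?_ ht1
    have h : (200 : ℝ) / 221 ≤ t := by linarith
    convert h using 1; norm_num
  · -- the adaptive member
    have hΔ1 : 5 / 2 * Real.log (5 / 4) + 3 / 2 * Δ ≤ Real.log 2 := by linarith
    obtain ⟨p, q, hq, hpq, h45, hδlo, hδhi⟩ := exists_member hΔ hΔ1
    have hq' : (0 : ℝ) < q := by exact_mod_cast hq
    obtain ⟨δ, hδdef⟩ : ∃ δ : ℝ, δ = (p : ℝ) / q * Real.log 2 - 5 / 2 * Real.log (5 / 4) := ⟨_, rfl⟩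
    rw [← hδdef] at hδlo hδhi
    have hδ0 : 0 < δ := by linarith
    -- the onset index `j₀ = max(16, ⌈2/δ⌉)`
    obtain ⟨j₀, hj₀def⟩ : ∃ j₀ : ℕ, j₀ = max 16 ⌈2 / δ⌉₊ := ⟨_, rfl⟩
    have hj₀ : 16 ≤ j₀ := by rw [hj₀def]; exact le_max_left _ _
    have hj₀' : ⌈2 / δ⌉₊ ≤ j₀ := by rw [hj₀def]; exact le_max_right _ _
    have hj₀ge : 2 / δ ≤ (j₀ : ℝ) := (Nat.le_ceil _).trans (by exact_mod_cast hj₀')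
    have hjδ : 2 ≤ (j₀ : ℝ) * δ := by
      have := (div_le_iff₀ hδ0).1 hj₀ge; linarith
    -- the band at `j₀`
    have hκ0 : 0 ≤ (p : ℝ) / q := by positivity
    have hκ1 : (p : ℝ) / q ≤ 1 := by rw [div_le_one hq']; exact_mod_cast hpq
    have hA : ((1 + (p : ℝ) / q) * Real.log (5 / 2) + (1 - (p : ℝ) / q) * Real.log 2) * (j₀ : ℝ) + 2 ≤
        (j₀ : ℝ) ^ 2 * ((5 / 2 + (p : ℝ) / q) * Real.log 2 - 5 / 2 * Real.log (5 / 2)) := by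
      have e : (5 / 2 + (p : ℝ) / q) * Real.log 2 - 5 / 2 * Real.log (5 / 2) = δ := by
        rw [hδdef, h54]; ring
      rw [e]; exact band_of_two_le hκ0 hκ1 hj₀ hjδ
    -- the rate
    have hCrate : (3 * (q : ℝ) + 2 * p) / (3 * q) * Real.log 2 ≤
        (5 * Real.log (5 / 4) + 3 * Real.log 2) / 3 + Δ := by
      have e : (3 * (q : ℝ) + 2 * p) / (3 * q) * Real.log 2 =
          Real.log 2 + 2 / 3 * ((p : ℝ) / q * Real.log 2) := by
        field_simp
      rw [e]; linarith
    -- the onset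
    have h34 : 3 * q ≤ 4 * p := by omega
    have hgap : 1 - t ≤ 3 / (2 * ((j₀ : ℝ) + 2)) := by
      rcases le_total ⌈2 / δ⌉₊ 16 with h16 | h16
      · have hj : j₀ = 16 := by rw [hj₀def]; exact max_eq_left h16
        rw [hj]; push_cast; norm_num; linarith
      · have hj : j₀ = ⌈2 / δ⌉₊ := by rw [hj₀def]; exact max_eq_right h16
        have hjlt : (j₀ : ℝ) < 2 / δ + 1 := by
          rw [hj]; exact Nat.ceil_lt_add_one (div_pos (by norm_num) hδ0).le
        have h2δ : 2 / δ ≤ 40 / (27 * Δ) := by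
          rw [div_le_div_iff₀ hδ0 (by positivity)]; linarith
        have hj' : (j₀ : ℝ) + 2 < (40 + 81 * Δ) / (27 * Δ) := by
          have e : (40 + 81 * Δ) / (27 * Δ) = 40 / (27 * Δ) + 3 := by
            field_simp; ring
          rw [e]; linarith
        have hj'' := (lt_div_iff₀ (by positivity : (0 : ℝ) < 27 * Δ)).1 hj'
        have h3 : 81 * Δ / (80 + 162 * Δ) ≤ 3 / (2 * ((j₀ : ℝ) + 2)) := by
          rw [div_le_div_iff₀ (by positivity) (by positivity)]
          nlinarith [hj'']
        linarith
    have hT : ((j₀ : ℝ) * ((3 * q * j₀ + 2 * q : ℕ) : ℝ)) /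
        (((j₀ : ℝ) + 1) * ((3 * q * j₀ + 2 * q + 2 * p : ℕ) : ℝ) + ((0 : ℕ) : ℝ)) ≤ t := by
      have := one_sub_t_ge p q j₀ hq h34
      linarith
    exact memberClause p q j₀ hq hpq h45 hj₀ hA hCrate t hT ht1

/-- **The eventual clause above the class ceiling with a formula onset.**  For every rate `C > c₂`
and every `t` with `max(11/12, 1 − 81(C−c₂)/(80 + 162(C−c₂))) ≤ t < 1` some `r ∈ [1, e^{C/(1−t)}]` has
`ω(1,t,r) = 1 + r` (`≤`); `t₀(C) = 1 − (81/80)(C − c₂) + O((C−c₂)²)`.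
[cite: CoppersmithWinograd1990, §8] [cite: AlmanDuanVassilevskaWilliamsXuXuZhou2025, Thm. 3.2, §3.4] -/
theorem clause_explicit {C : ℝ} (hC : (5 * Real.log (5 / 4) + 3 * Real.log 2) / 3 < C) :
    ∀ t : ℝ, max (11 / 12) (1 - 81 * (C - (5 * Real.log (5 / 4) + 3 * Real.log 2) / 3) /
        (80 + 162 * (C - (5 * Real.log (5 / 4) + 3 * Real.log 2) / 3))) ≤ t → t < 1 →
      ∃ r : ℝ, 1 ≤ r ∧ r ≤ Real.exp (C / (1 - t)) ∧ omegaRect ℂ 1 t r ≤ 1 + r := by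
  intro t ht ht1
  have hΔ : 0 < C - (5 * Real.log (5 / 4) + 3 * Real.log 2) / 3 := by linarith
  obtain ⟨r, hr1, hr, hcert⟩ := clause_delta hΔ t (le_trans (le_max_left _ _) ht)
    (le_trans (le_max_right _ _) ht) ht1
  refine ⟨r, hr1, ?_, hcert⟩
  have e : (5 * Real.log (5 / 4) + 3 * Real.log 2) / 3 +
      (C - (5 * Real.log (5 / 4) + 3 * Real.log 2) / 3) = C := by ring
  rw [e] at hr
  exact hr

/-- The same with the onset as a named witness: `∃ t₀ = max(11/12, 1 − 81Δ/(80+162Δ)) < 1` such that the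
clause at rate `C` holds on `[t₀, 1)` — the explicit form of `…GaugeConeClasses.clause_above_classCeiling`.
[cite: CoppersmithWinograd1990, §8] [cite: AlmanDuanVassilevskaWilliamsXuXuZhou2025, Thm. 3.2, §3.4] -/
theorem clause_explicit_onset {C : ℝ} (hC : (5 * Real.log (5 / 4) + 3 * Real.log 2) / 3 < C) :
    ∃ t₀ : ℝ, t₀ = max (11 / 12) (1 - 81 * (C - (5 * Real.log (5 / 4) + 3 * Real.log 2) / 3) /
        (80 + 162 * (C - (5 * Real.log (5 / 4) + 3 * Real.log 2) / 3))) ∧ t₀ < 1 ∧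
      ∀ t : ℝ, t₀ ≤ t → t < 1 →
        ∃ r : ℝ, 1 ≤ r ∧ r ≤ Real.exp (C / (1 - t)) ∧ omegaRect ℂ 1 t r ≤ 1 + r := by
  have hΔ : 0 < C - (5 * Real.log (5 / 4) + 3 * Real.log 2) / 3 := by linarith
  refine ⟨_, rfl, max_lt (by norm_num) ?_, clause_explicit hC⟩
  have : 0 < 81 * (C - (5 * Real.log (5 / 4) + 3 * Real.log 2) / 3) /
      (80 + 162 * (C - (5 * Real.log (5 / 4) + 3 * Real.log 2) / 3)) := by positivity
  linarith

/-! ## The continuum form: the class ceiling along `t ↑ 1` -/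

/-- **The class ceiling along the continuum.**  For every `t ∈ [11/12, 1)` some `r ∈ [1, e^{c₂/(1−t) + 6/5}]`
has `ω(1,t,r) = 1 + r` (`≤`): take `Δ = 80(1−t)/(81 − 162(1−t))`, for which `1 − 81Δ/(80+162Δ) = t`
exactly and `Δ/(1−t) = 80/(81 − 162(1−t)) ≤ 32/27 < 6/5`.
[cite: CoppersmithWinograd1990, §8] [cite: AlmanDuanVassilevskaWilliamsXuXuZhou2025, Thm. 3.2, §3.4] -/
theorem ceiling_continuum : ∀ t : ℝ, 11 / 12 ≤ t → t < 1 →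
    ∃ r : ℝ, 1 ≤ r ∧ r ≤ Real.exp ((5 * Real.log (5 / 4) + 3 * Real.log 2) / 3 / (1 - t) + 6 / 5) ∧
      omegaRect ℂ 1 t r ≤ 1 + r := by
  intro t ht ht1
  have hs0 : 0 < 1 - t := by linarith
  have hs : 1 - t ≤ 1 / 12 := by linarith
  have hden : 0 < 81 - 162 * (1 - t) := by linarith
  obtain ⟨Δ, hΔdef⟩ : ∃ Δ : ℝ, Δ = 80 * (1 - t) / (81 - 162 * (1 - t)) := ⟨_, rfl⟩
  have hΔ : 0 < Δ := by rw [hΔdef]; exact div_pos (by linarith) hden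
  have hΔmul : Δ * (81 - 162 * (1 - t)) = 80 * (1 - t) := by
    rw [hΔdef]; exact div_mul_cancel₀ _ hden.ne'
  have honset : 1 - 81 * Δ / (80 + 162 * Δ) ≤ t := by
    have h : 1 - t ≤ 81 * Δ / (80 + 162 * Δ) := by
      rw [le_div_iff₀ (by positivity)]; nlinarith [hΔmul]
    linarith
  obtain ⟨r, hr1, hr, hcert⟩ := clause_delta hΔ t ht honset ht1
  refine ⟨r, hr1, hr.trans (Real.exp_le_exp.2 ?_), hcert⟩
  have hΔle : Δ ≤ 6 / 5 * (1 - t) := by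
    rw [hΔdef, div_le_iff₀ hden]
    have h1 : (135 : ℝ) / 2 ≤ 81 - 162 * (1 - t) := by linarith
    nlinarith [mul_le_mul_of_nonneg_right h1 hs0.le]
  have hq : Δ / (1 - t) ≤ 6 / 5 := by rw [div_le_iff₀ hs0]; exact hΔle
  rw [add_div]
  linarith

/-- The same in DEFECT currency: `∀ t ∈ [11/12, 1) ∃ r ≥ 1` exact with `(1−t) log r ≤ c₂ + (6/5)(1−t)`.
[cite: CoppersmithWinograd1990, §8] [cite: AlmanDuanVassilevskaWilliamsXuXuZhou2025, Thm. 3.2, §3.4] -/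
theorem ceiling_continuum_defect : ∀ t : ℝ, 11 / 12 ≤ t → t < 1 →
    ∃ r : ℝ, 1 ≤ r ∧
      (1 - t) * Real.log r ≤ (5 * Real.log (5 / 4) + 3 * Real.log 2) / 3 + 6 / 5 * (1 - t) ∧
      omegaRect ℂ 1 t r ≤ 1 + r := by
  intro t ht ht1
  have hs0 : 0 < 1 - t := by linarith
  obtain ⟨r, hr1, hr, hcert⟩ := ceiling_continuum t ht ht1
  refine ⟨r, hr1, ?_, hcert⟩
  have hlog : Real.log r ≤ (5 * Real.log (5 / 4) + 3 * Real.log 2) / 3 / (1 - t) + 6 / 5 := by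
    have h := Real.log_le_log (by linarith) hr
    rwa [Real.log_exp] at h
  have h2 := mul_le_mul_of_nonneg_left hlog hs0.le
  have e : (1 - t) * ((5 * Real.log (5 / 4) + 3 * Real.log 2) / 3 / (1 - t) + 6 / 5) =
      (5 * Real.log (5 / 4) + 3 * Real.log 2) / 3 + 6 / 5 * (1 - t) := by
    field_simp
  linarith [h2, e]

/-! ## Instances of the formula -/

/-- Instance scheme: if `θ(80 + 162(C − c₂)) ≤ 81(C − c₂)`, `11/12 ≤ t₁` and `1 − θ ≤ t₁`, the clause at
rate `C` holds on `[t₁, 1)`. [folklore] -/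
theorem clause_at {C θ t₁ : ℝ} (hC : (5 * Real.log (5 / 4) + 3 * Real.log 2) / 3 < C)
    (h11 : 11 / 12 ≤ t₁)
    (hθ : θ * (80 + 162 * (C - (5 * Real.log (5 / 4) + 3 * Real.log 2) / 3)) ≤
      81 * (C - (5 * Real.log (5 / 4) + 3 * Real.log 2) / 3)) (ht₁ : 1 - θ ≤ t₁) :
    ∀ t : ℝ, t₁ ≤ t → t < 1 →
      ∃ r : ℝ, 1 ≤ r ∧ r ≤ Real.exp (C / (1 - t)) ∧ omegaRect ℂ 1 t r ≤ 1 + r := by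
  intro t ht ht1
  have hΔ : 0 < C - (5 * Real.log (5 / 4) + 3 * Real.log 2) / 3 := by linarith
  refine clause_explicit hC t (max_le (by linarith) ?_) ht1
  have h : θ ≤ 81 * (C - (5 * Real.log (5 / 4) + 3 * Real.log 2) / 3) /
      (80 + 162 * (C - (5 * Real.log (5 / 4) + 3 * Real.log 2) / 3)) := by
    rw [le_div_iff₀ (by positivity)]; exact hθ
  linarith

/-- Rate `1.07` from `t = 0.99505` (`Δ ≥ 0.00494`; the XXVIII table gives `0.99546` via `κ = 13/16`).
[cite: CoppersmithWinograd1990, §8] [cite: AlmanDuanVassilevskaWilliamsXuXuZhou2025, Thm. 3.2, §3.4] -/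
theorem clause_107 : ∀ t : ℝ, (0.99505 : ℝ) ≤ t → t < 1 →
    ∃ r : ℝ, 1 ≤ r ∧ r ≤ Real.exp (1.07 / (1 - t)) ∧ omegaRect ℂ 1 t r ≤ 1 + r := by
  have hc := classCeiling_bounds
  exact clause_at (θ := 0.00495) (by linarith [hc.2]) (by norm_num) (by linarith [hc.2]) (by norm_num)

/-- Rate `1.066` from `t = 0.99906` (`Δ ≥ 0.00094`; cf. `clause_21_26`: `1.0664` from `0.99830`).
[cite: CoppersmithWinograd1990, §8] [cite: AlmanDuanVassilevskaWilliamsXuXuZhou2025, Thm. 3.2, §3.4] -/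
theorem clause_1066 : ∀ t : ℝ, (0.99906 : ℝ) ≤ t → t < 1 →
    ∃ r : ℝ, 1 ≤ r ∧ r ≤ Real.exp (1.066 / (1 - t)) ∧ omegaRect ℂ 1 t r ≤ 1 + r := by
  have hc := classCeiling_bounds
  exact clause_at (θ := 0.00094) (by linarith [hc.2]) (by norm_num) (by linarith [hc.2]) (by norm_num)

/-- Rate `1.0655` from `t = 0.99956` (`Δ ≥ 0.00044`).
[cite: CoppersmithWinograd1990, §8] [cite: AlmanDuanVassilevskaWilliamsXuXuZhou2025, Thm. 3.2, §3.4] -/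
theorem clause_10655 : ∀ t : ℝ, (0.99956 : ℝ) ≤ t → t < 1 →
    ∃ r : ℝ, 1 ≤ r ∧ r ≤ Real.exp (1.0655 / (1 - t)) ∧ omegaRect ℂ 1 t r ≤ 1 + r := by
  have hc := classCeiling_bounds
  exact clause_at (θ := 0.00044) (by linarith [hc.2]) (by norm_num) (by linarith [hc.2]) (by norm_num)

/-- Rate `1.0651` from `t = 0.99996` (`Δ ≥ 0.00004` by `classCeiling_bounds`; true `Δ = 4.7·10⁻⁵`) —
within `5·10⁻⁵` of the class ceiling.
[cite: CoppersmithWinograd1990, §8] [cite: AlmanDuanVassilevskaWilliamsXuXuZhou2025, Thm. 3.2, §3.4] -/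
theorem clause_10651 : ∀ t : ℝ, (0.99996 : ℝ) ≤ t → t < 1 →
    ∃ r : ℝ, 1 ≤ r ∧ r ≤ Real.exp (1.0651 / (1 - t)) ∧ omegaRect ℂ 1 t r ≤ 1 + r := by
  have hc := classCeiling_bounds
  exact clause_at (θ := 0.00004) (by linarith [hc.2]) (by norm_num) (by linarith [hc.2]) (by norm_num)

end Summit.MatrixMultiplication.MatrixMultiplication.Theorems.SaturationLadderExplicitCeilingClause
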